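import Mathlib
import HarnessLib
import Summits.NavierStokesRegularity.NavierStokesRegularity.Theorems.UnthreadedRigidityDoorUnthreadedRigidityHornPressureField
import Summits.NavierStokesRegularity.NavierStokesRegularity.Theorems.UnthreadedRigidityDoorUnthreadedRigidityVirialHornOrderTwoLaw
import Summits.NavierStokesRegularity.NavierStokesRegularity.Theorems.UnthreadedRigidityDoorUnthreadedRigidityVirialHornOrderTwoBracket
import Summits.NavierStokesRegularity.NavierStokesRegularity.Theorems.UnthreadedRigidityDoorUnthreadedRigidityThreadingJetsRungs
import Summits.NavierStokesRegularity.NavierStokesRegularity.Theorems.UnthreadedRigidityDoorUnthreadedRigidityProfileHornZonalAxis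

/-!
# Route `UnthreadedRigidityDoor`, item `UnthreadedRigidity` (W2, stmt-NavierStokesRegularity-27585) — LINE g10-2 «PROFILE HORN»,
# BRIDGE PH BY NAME: the `l = 2` pressure bracket, `hornSliceIdentityTwo_holds`, `hornIdentityTwo_holds`,
# and the SLICE RUNG `separableShellOrderTwoRigidity_holds`

Prover file (W2 Lean hand ns-crc-p1 g9, by lineage; `--supports stmt-NavierStokesRegularity-27585 --as helper`).  Files 1–5
(`…HornPressure{Defs,Source,Radial,Harmonics,Channels,Field}`) identified the decaying slice pressure of the separable `l = 2` shell with the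
explicit multipole pressure `p* = shellPressure Q h` re-centred at `x₀`.  Here:

* `fderiv_radial_mul_apply_self` — `D(β(|z|²)S)(z)·z = (2|z|²β′ + Lβ)(|z|²)·S(z)`; `inner_gradient_shellPressure` — the radial flux
  `⟪z, ∇p*(z)⟫ = tr Q²·ẽ₀ + ẽ₂ S₂ + ẽ₄ S₄` with the Euler coefficients `ẽ_L = 2sβ_L′ + Lβ_L`;
* `pbr_quadY_sqForm` (`{Y_Q, S₂} = 4 D_Q`), `pbr_quadY_quartic` (`{Y_Q, S₄} = −(16/7)|z|² D_Q`), `pbr_quadY_inner_gradient_shellPressure`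
  (`{Y_Q, z·∇p*} = D_Q·(4ẽ₂ − (16/7)|z|² ẽ₄)` — the monopole drops out; `D_Q(r y) = r³ D_Q(y)` is g7's `ProfileHorn.discrCubic_smul`);
* `eulerCoeff_two_eq` / `eulerCoeff_four_eq` — `ẽ_L(r²) = ProfileHorn.eulerPressure (a_L H) L r` (`…HornPressureRadial.eulerCoeff_radCoeff` +
  g7's `innerMoment_a*_eq` / `outerMoment_a*_eq`);
* ★ `pressureBracket_two` — THE `l = 2` PRESSURE BRACKET for the decaying slice pressure:
  `{Y_Q, z·∇p₀(x₀+z)}(r y) = r³ D_Q(y)·(4e₂(r) − (16/7)r²e₄(r))`;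
* ★★ `hornSliceIdentityTwo_holds : ThreadingJets.HornSliceIdentityTwo` (with crc-p2 g8's `VirialHorn.fluxJetTwo_sepShell_eq`);
* ★★ `hornIdentityTwo_holds : ProfileHorn.HornIdentityTwo` — BRIDGE PH of LINE g10-2 BY NAME (`ThreadingJets.hornIdentityTwo_of_slice`, p704808);
* ★★ `separableShellOrderTwoRigidity_holds : ProfileHorn.SeparableShellOrderTwoRigidity` — the `l = 2` SLICE RUNG for EVERY horn-admissible
  profile, plateau profiles included (`ThreadingJets.separableShellOrderTwoRigidity_of_hornSlice`, p705584, whose engine is g7's PHR p692614).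

HONEST LABEL: these close the PROFILE HORN line's slice side in the kernel (its window side is engine-1 g72's `separableWindowRigidity_holds`,
p715559): statements about SPECIAL (separable `l = 2`) slice data of classical solutions with decaying pressure.  `UnthreadedRigidity` (27585),
W2 and NS regularity remain OPEN; no summit statement is proved here.  0 kit.
-/

-- the summit and its single sub-problem share the name (CONVENTIONS §1), as in every Theorems file
set_option linter.dupNamespace false

noncomputable section

namespace Summit.NavierStokesRegularity.NavierStokesRegularity.Theorems.UnthreadedRigidity.HornPressure

open scoped RealInnerProductSpace Topology ContDiff Laplacian
open Filter Set MeasureTheory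
open Literature.Analysis.FluidPDE
open Summit.NavierStokesRegularity.NavierStokesRegularity.Theorems.UnthreadedRigidity.ProfileHorn
  (E3 IsQuadForm quadY discrCubic sepShell HornAdmissible aTwo aFour innerMoment outerMoment eulerPressure hornBracket vortAmp strainAmp
   det_rows_three discrCubic_smul innerMoment_aTwo_eq innerMoment_aFour_eq outerMoment_aTwo_eq outerMoment_aFour_eq)
open Summit.NavierStokesRegularity.NavierStokesRegularity.Theorems.UnthreadedRigidity.VirialHorn
open Summit.NavierStokesRegularity.NavierStokesRegularity.Theorems.UnthreadedRigidity.ThreadingJets (HornSliceIdentityTwo fluxJetTwo)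

variable {Q : Matrix (Fin 3) (Fin 3) ℝ} {h H : ℝ → ℝ} {C : ℝ}

/-! ## The radial flux `⟪z, ∇p*(z)⟫` -/

/-- `D(β(|z|²)·S)(z)·z = (2|z|²β′(|z|²) + Lβ(|z|²))·S(z)` for differentiable `β` and `S` with the Euler identity `DS(z)·z = L S(z)`. -/
theorem fderiv_radial_mul_apply_self {β : ℝ → ℝ} (hβ : Differentiable ℝ β) {S : E3 → ℝ} {z : E3} (hS : DifferentiableAt ℝ S z)
    {L : ℝ} (hE : fderiv ℝ S z z = L * S z) :
    fderiv ℝ (fun w : E3 => β (‖w‖ ^ 2) * S w) z z = (2 * ‖z‖ ^ 2 * deriv β (‖z‖ ^ 2) + L * β (‖z‖ ^ 2)) * S z := by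
  have hN : HasFDerivAt (fun w : E3 => ‖w‖ ^ 2) (2 • innerSL ℝ z) z := (hasStrictFDerivAt_norm_sq z).hasFDerivAt
  have hc := (hβ (‖z‖ ^ 2)).hasDerivAt.comp_hasFDerivAt z hN
  have hc' : HasFDerivAt (fun w : E3 => β (‖w‖ ^ 2)) (deriv β (‖z‖ ^ 2) • (2 • innerSL ℝ z)) z :=
    hc.congr_of_eventuallyEq (Eventually.of_forall fun w => rfl)
  rw [fderiv_fun_mul hc'.differentiableAt hS, hc'.fderiv]
  simp [two_smul, hE]
  ring

/-- THE RADIAL FLUX of the explicit pressure: `⟪z, ∇p*(z)⟫ = tr Q²·ẽ₀(s) + ẽ₂(s)·S₂(z) + ẽ₄(s)·S₄(z)`, `ẽ_L = 2sβ_L′ + Lβ_L`, `s = |z|²`. -/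
theorem inner_gradient_shellPressure (hQ : IsQuadForm Q) (hh : ContDiff ℝ ∞ h) (hH : ∀ r, 0 ≤ r → H r = h (r ^ 2))
    (hC : ∀ r, 1 ≤ r → r ^ 5 * |H r| ≤ C ∧ r ^ 6 * |deriv H r| ≤ C ∧ r ^ 7 * |deriv (deriv H) r| ≤ C) (z : E3) :
    inner ℝ z (gradient (shellPressure Q h) z) =
      Matrix.trace (Q * Q) * (2 * ‖z‖ ^ 2 * deriv (radCoeff 0 (chanZero h)) (‖z‖ ^ 2))
      + (2 * ‖z‖ ^ 2 * deriv (radCoeff 2 (chanTwo h)) (‖z‖ ^ 2) + 2 * radCoeff 2 (chanTwo h) (‖z‖ ^ 2)) * quadY (sqForm Q) z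
      + (2 * ‖z‖ ^ 2 * deriv (radCoeff 4 (chanFour h)) (‖z‖ ^ 2) + 4 * radCoeff 4 (chanFour h) (‖z‖ ^ 2)) * quartic Q z := by
  have hQ2 := isQuadForm_sqForm hQ.1
  have hb0 : Differentiable ℝ (radCoeff 0 (chanZero h)) :=
    (contDiff_radCoeff (contDiff_chanZero hh) 0 (fun σ hσ => abs_chanZero_le hh hH hC hσ)).differentiable (by simp)
  have hb2 : Differentiable ℝ (radCoeff 2 (chanTwo h)) :=
    (contDiff_radCoeff (contDiff_chanTwo hh) 2 (fun σ hσ => abs_chanTwo_le hh hH hC hσ)).differentiable (by simp)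
  have hb4 : Differentiable ℝ (radCoeff 4 (chanFour h)) :=
    (contDiff_radCoeff (contDiff_chanFour hh) 4 (fun σ hσ => abs_chanFour_le hh hH hC hσ)).differentiable (by simp)
  have hS2 : DifferentiableAt ℝ (quadY (sqForm Q)) z := ((isSolidHarmonic_quadY hQ2).contDiff.differentiable (by simp)) z
  have hS4 : DifferentiableAt ℝ (quartic Q) z := ((contDiff_quartic Q hQ).differentiable (by simp)) z
  have hd0 : DifferentiableAt ℝ (fun w : E3 => radCoeff 0 (chanZero h) (‖w‖ ^ 2) * Matrix.trace (Q * Q)) z :=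
    (differentiableAt_radial hb0 z).mul (differentiableAt_const _)
  have hd2 : DifferentiableAt ℝ (fun w : E3 => radCoeff 2 (chanTwo h) (‖w‖ ^ 2) * quadY (sqForm Q) w) z :=
    (differentiableAt_radial hb2 z).mul hS2
  have hd4 : DifferentiableAt ℝ (fun w : E3 => radCoeff 4 (chanFour h) (‖w‖ ^ 2) * quartic Q w) z :=
    (differentiableAt_radial hb4 z).mul hS4
  have hfun : shellPressure Q h = fun w : E3 => radCoeff 0 (chanZero h) (‖w‖ ^ 2) * Matrix.trace (Q * Q)
      + radCoeff 2 (chanTwo h) (‖w‖ ^ 2) * quadY (sqForm Q) w + radCoeff 4 (chanFour h) (‖w‖ ^ 2) * quartic Q w := by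
    funext w; simp only [shellPressure]; ring
  have hF : HasFDerivAt (shellPressure Q h)
      (fderiv ℝ (fun w : E3 => radCoeff 0 (chanZero h) (‖w‖ ^ 2) * Matrix.trace (Q * Q)) z
        + fderiv ℝ (fun w : E3 => radCoeff 2 (chanTwo h) (‖w‖ ^ 2) * quadY (sqForm Q) w) z
        + fderiv ℝ (fun w : E3 => radCoeff 4 (chanFour h) (‖w‖ ^ 2) * quartic Q w) z) z := by
    rw [hfun]
    exact (hd0.hasFDerivAt.add hd2.hasFDerivAt).add hd4.hasFDerivAt
  rw [real_inner_comm, gradient, InnerProductSpace.toDual_symm_apply, hF.fderiv]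
  simp only [FunLike.coe_add, Pi.add_apply]
  rw [fderiv_radial_mul_apply_self hb0 (differentiableAt_const _) (L := 0) (by simp),
    fderiv_radial_mul_apply_self hb2 hS2 (fderiv_quadY_apply_self hQ2 z),
    fderiv_radial_mul_apply_self hb4 hS4 (fderiv_quartic_apply_self hQ z)]
  ring

/-! ## The brackets `{Y_Q, S₂}`, `{Y_Q, S₄}`, `{Y_Q, z·∇p*}` -/

/-- `{Y_Q, S₂} = 4 D_Q` (`S₂ = quadY (sqForm Q)`, `D_Q = det[z, Qz, Q²z]`). -/
theorem pbr_quadY_sqForm (hQ : IsQuadForm Q) (z : E3) : pbr (quadY Q) (quadY (sqForm Q)) z = 4 * discrCubic Q z := by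
  have hs : ∀ i j : Fin 3, Q j i = Q i j := fun i j => by
    have := congrFun (congrFun hQ.1 i) j
    simpa [Matrix.transpose_apply] using this
  have h10 : Q 1 0 = Q 0 1 := hs 0 1
  have h20 : Q 2 0 = Q 0 2 := hs 0 2
  have h21 : Q 2 1 = Q 1 2 := hs 1 2
  unfold pbr
  rw [(hasGradientAt_quadY hQ.1 z).gradient, (hasGradientAt_quadY (isQuadForm_sqForm hQ.1).1 z).gradient]
  unfold discrCubic
  rw [det_rows_three]
  simp only [det3, sqForm, Matrix.sub_apply, Matrix.mul_apply, Matrix.smul_apply, Matrix.one_apply, Matrix.mulVec, dotProduct,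
    Fin.sum_univ_three, smul_eq_mul, h10, h20, h21]
  simp (decide := true) only [if_true, if_false, mul_one, mul_zero, sub_zero]
  ring

/-- `{Y_Q, S₄} = −(16/7)|z|² D_Q` (`{Y,Y²} = 0`, radial factors pass through, `{Y_Q,S₂} = 4D_Q`). -/
theorem pbr_quadY_quartic (hQ : IsQuadForm Q) (z : E3) : pbr (quadY Q) (quartic Q) z = -(16 / 7) * ‖z‖ ^ 2 * discrCubic Q z := by
  have hQ2 := isQuadForm_sqForm hQ.1
  have hYd : Differentiable ℝ (quadY Q) := (isSolidHarmonic_quadY hQ).contDiff.differentiable (by simp)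
  have hSd : Differentiable ℝ (quadY (sqForm Q)) := (isSolidHarmonic_quadY hQ2).contDiff.differentiable (by simp)
  have hNd : Differentiable ℝ (fun w : E3 => ‖w‖ ^ 2) := (contDiff_norm_sq ℝ (n := 1)).differentiable one_ne_zero
  have h1 : DifferentiableAt ℝ (fun w : E3 => quadY Q w ^ 2) z :=
    (((isSolidHarmonic_quadY hQ).contDiff.pow 2).differentiable (by simp)) z
  have h2 : DifferentiableAt ℝ (fun w : E3 => 4 / 7 * ‖w‖ ^ 2 * quadY (sqForm Q) w) z :=
    ((differentiableAt_const (4 / 7 : ℝ)).mul (hNd z)).mul (hSd z)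
  have h3 : DifferentiableAt ℝ (fun w : E3 => 2 / 15 * Matrix.trace (Q * Q) * (‖w‖ ^ 2) ^ 2) z :=
    (differentiableAt_const _).mul ((((contDiff_norm_sq ℝ (E := E3) (n := 1)).pow 2).differentiable one_ne_zero) z)
  have hfun : quartic Q = fun w : E3 => (quadY Q w ^ 2 - 4 / 7 * ‖w‖ ^ 2 * quadY (sqForm Q) w)
      - 2 / 15 * Matrix.trace (Q * Q) * (‖w‖ ^ 2) ^ 2 := rfl
  have h12 : DifferentiableAt ℝ (fun w : E3 => quadY Q w ^ 2 - 4 / 7 * ‖w‖ ^ 2 * quadY (sqForm Q) w) z := h1.sub h2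
  rw [hfun, pbr_sub (quadY Q) (g₁ := fun w : E3 => quadY Q w ^ 2 - 4 / 7 * ‖w‖ ^ 2 * quadY (sqForm Q) w)
      (g₂ := fun w : E3 => 2 / 15 * Matrix.trace (Q * Q) * (‖w‖ ^ 2) ^ 2) h12 h3,
    pbr_sub (quadY Q) (g₁ := fun w : E3 => quadY Q w ^ 2) (g₂ := fun w : E3 => 4 / 7 * ‖w‖ ^ 2 * quadY (sqForm Q) w) h1 h2,
    pbr_self_sq (isSolidHarmonic_quadY hQ)]
  -- the middle term: `{Y, (4/7)|z|² S₂} = (4/7)|z|² {Y,S₂}`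
  have hmid : pbr (quadY Q) (fun w : E3 => 4 / 7 * ‖w‖ ^ 2 * quadY (sqForm Q) w) z = 4 / 7 * ‖z‖ ^ 2 * (4 * discrCubic Q z) := by
    rw [show (fun w : E3 => 4 / 7 * ‖w‖ ^ 2 * quadY (sqForm Q) w) = fun w => (fun σ : ℝ => 4 / 7 * σ) (‖w‖ ^ 2) * quadY (sqForm Q) w
        from funext fun w => by beta_reduce; ring,
      pbr_radial_mul (ρ := fun σ : ℝ => 4 / 7 * σ) (differentiable_id.const_mul _) (quadY Q) (hSd z), pbr_quadY_sqForm hQ]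
  -- the radial term: `{Y, c|z|⁴} = 0`
  have hrad : pbr (quadY Q) (fun w : E3 => 2 / 15 * Matrix.trace (Q * Q) * (‖w‖ ^ 2) ^ 2) z = 0 := by
    rw [show (fun w : E3 => 2 / 15 * Matrix.trace (Q * Q) * (‖w‖ ^ 2) ^ 2) =
        fun w => (fun σ : ℝ => 2 / 15 * Matrix.trace (Q * Q) * σ ^ 2) (‖w‖ ^ 2) * (fun _ : E3 => (1 : ℝ)) w
        from funext fun w => by beta_reduce; ring,
      pbr_radial_mul (ρ := fun σ : ℝ => 2 / 15 * Matrix.trace (Q * Q) * σ ^ 2) ((differentiable_id.pow 2).const_mul _) (quadY Q)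
        (g := fun _ : E3 => (1 : ℝ)) (differentiableAt_const _)]
    simp [pbr, det3, gradient]
  rw [hmid, hrad]
  ring

/-- `{Y_Q, z·∇p*} = D_Q(z)·(4ẽ₂(|z|²) − (16/7)|z|² ẽ₄(|z|²))` — the monopole channel drops out of the bracket. -/
theorem pbr_quadY_inner_gradient_shellPressure (hQ : IsQuadForm Q) (hh : ContDiff ℝ ∞ h) (hH : ∀ r, 0 ≤ r → H r = h (r ^ 2))
    (hC : ∀ r, 1 ≤ r → r ^ 5 * |H r| ≤ C ∧ r ^ 6 * |deriv H r| ≤ C ∧ r ^ 7 * |deriv (deriv H) r| ≤ C) (z : E3) :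
    pbr (quadY Q) (fun w : E3 => inner ℝ w (gradient (shellPressure Q h) w)) z =
      discrCubic Q z * (4 * (2 * ‖z‖ ^ 2 * deriv (radCoeff 2 (chanTwo h)) (‖z‖ ^ 2) + 2 * radCoeff 2 (chanTwo h) (‖z‖ ^ 2))
        - 16 / 7 * ‖z‖ ^ 2 * (2 * ‖z‖ ^ 2 * deriv (radCoeff 4 (chanFour h)) (‖z‖ ^ 2) + 4 * radCoeff 4 (chanFour h) (‖z‖ ^ 2))) := by
  have hQ2 := isQuadForm_sqForm hQ.1
  have hc0 := contDiff_radCoeff (contDiff_chanZero hh) 0 (fun σ hσ => abs_chanZero_le hh hH hC hσ)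
  have hc2 := contDiff_radCoeff (contDiff_chanTwo hh) 2 (fun σ hσ => abs_chanTwo_le hh hH hC hσ)
  have hc4 := contDiff_radCoeff (contDiff_chanFour hh) 4 (fun σ hσ => abs_chanFour_le hh hH hC hσ)
  -- the Euler coefficients as smooth functions of `s`
  set e0 : ℝ → ℝ := fun s => Matrix.trace (Q * Q) * (2 * s * deriv (radCoeff 0 (chanZero h)) s) with he0
  set e2 : ℝ → ℝ := fun s => 2 * s * deriv (radCoeff 2 (chanTwo h)) s + 2 * radCoeff 2 (chanTwo h) s with he2
  set e4 : ℝ → ℝ := fun s => 2 * s * deriv (radCoeff 4 (chanFour h)) s + 4 * radCoeff 4 (chanFour h) s with he4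
  have hd' : ∀ {β : ℝ → ℝ}, ContDiff ℝ ∞ β → Differentiable ℝ (deriv β) := fun hβ =>
    (contDiff_deriv_of_contDiff_top hβ).differentiable (by simp)
  have he0d : Differentiable ℝ e0 := ((differentiable_id.const_mul _).mul (hd' hc0)).const_mul _
  have he2d : Differentiable ℝ e2 :=
    ((differentiable_id.const_mul _).mul (hd' hc2)).add ((hc2.differentiable (by simp)).const_mul _)
  have he4d : Differentiable ℝ e4 :=
    ((differentiable_id.const_mul _).mul (hd' hc4)).add ((hc4.differentiable (by simp)).const_mul _)
  have hfun : (fun w : E3 => inner ℝ w (gradient (shellPressure Q h) w)) =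
      fun w => (e0 (‖w‖ ^ 2) * (fun _ : E3 => (1 : ℝ)) w + e2 (‖w‖ ^ 2) * quadY (sqForm Q) w) + e4 (‖w‖ ^ 2) * quartic Q w := by
    funext w
    rw [inner_gradient_shellPressure hQ hh hH hC w]
    simp only [he0, he2, he4]
    ring
  have hS2 : DifferentiableAt ℝ (quadY (sqForm Q)) z := ((isSolidHarmonic_quadY hQ2).contDiff.differentiable (by simp)) z
  have hS4 : DifferentiableAt ℝ (quartic Q) z := ((contDiff_quartic Q hQ).differentiable (by simp)) z
  have hA : DifferentiableAt ℝ (fun w : E3 => e0 (‖w‖ ^ 2) * (fun _ : E3 => (1 : ℝ)) w) z :=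
    (differentiableAt_radial he0d z).mul (differentiableAt_const _)
  have hB : DifferentiableAt ℝ (fun w : E3 => e2 (‖w‖ ^ 2) * quadY (sqForm Q) w) z := (differentiableAt_radial he2d z).mul hS2
  have hCd : DifferentiableAt ℝ (fun w : E3 => e4 (‖w‖ ^ 2) * quartic Q w) z := (differentiableAt_radial he4d z).mul hS4
  have hAB : DifferentiableAt ℝ (fun w : E3 => e0 (‖w‖ ^ 2) * (fun _ : E3 => (1 : ℝ)) w + e2 (‖w‖ ^ 2) * quadY (sqForm Q) w) z :=
    hA.add hB
  rw [hfun, pbr_add (quadY Q) (g₁ := fun w : E3 => e0 (‖w‖ ^ 2) * (fun _ : E3 => (1 : ℝ)) w + e2 (‖w‖ ^ 2) * quadY (sqForm Q) w)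
      (g₂ := fun w : E3 => e4 (‖w‖ ^ 2) * quartic Q w) hAB hCd,
    pbr_add (quadY Q) (g₁ := fun w : E3 => e0 (‖w‖ ^ 2) * (fun _ : E3 => (1 : ℝ)) w) (g₂ := fun w : E3 => e2 (‖w‖ ^ 2) * quadY (sqForm Q) w) hA hB,
    pbr_radial_mul he0d (quadY Q) (differentiableAt_const _), pbr_radial_mul he2d (quadY Q) hS2,
    pbr_radial_mul he4d (quadY Q) hS4, pbr_quadY_sqForm hQ, pbr_quadY_quartic hQ]
  have h1 : pbr (quadY Q) (fun _ : E3 => (1 : ℝ)) z = 0 := by simp [pbr, det3, gradient]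
  rw [h1]
  simp only [he2, he4]
  ring

/-! ## The Euler coefficients are g7's `eulerPressure` -/

/-- `ẽ₂(r²) = eulerPressure (aTwo H) 2 r` (`r > 0`). -/
theorem eulerCoeff_two_eq (hh : ContDiff ℝ ∞ h) (hH : ∀ r, 0 ≤ r → H r = h (r ^ 2))
    (hC : ∀ r, 1 ≤ r → r ^ 5 * |H r| ≤ C ∧ r ^ 6 * |deriv H r| ≤ C ∧ r ^ 7 * |deriv (deriv H) r| ≤ C) {r : ℝ} (hr : 0 < r) :
    2 * r ^ 2 * deriv (radCoeff 2 (chanTwo h)) (r ^ 2) + 2 * radCoeff 2 (chanTwo h) (r ^ 2) = eulerPressure (aTwo H) 2 r := by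
  have key := eulerCoeff_radCoeff (contDiff_chanTwo hh) 2 (fun σ hσ => abs_chanTwo_le hh hH hC hσ) hr
  push_cast at key
  rw [key, eulerPressure, innerMoment_aTwo_eq hh hH hr.le, outerMoment_aTwo_eq hh hH hr.le]
  have hI : (∫ ρ in (0:ℝ)..r, ρ ^ (2 * 2 + 2) * chanTwo h (ρ ^ 2)) = ∫ ρ in (0:ℝ)..r, ρ ^ 6 * (24 / 7 * (4 * ρ ^ 2 * deriv h (ρ ^ 2) ^ 2
      + 42 * h (ρ ^ 2) * deriv h (ρ ^ 2) + 12 * ρ ^ 2 * h (ρ ^ 2) * deriv (deriv h) (ρ ^ 2)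
      - 8 * ρ ^ 4 * deriv h (ρ ^ 2) * deriv (deriv h) (ρ ^ 2))) :=
    intervalIntegral.integral_congr fun ρ _ => by unfold chanTwo; ring
  have hJ : (∫ ρ in Ioi r, ρ * chanTwo h (ρ ^ 2)) = ∫ ρ in Ioi r, ρ * (24 / 7 * (4 * ρ ^ 2 * deriv h (ρ ^ 2) ^ 2
      + 42 * h (ρ ^ 2) * deriv h (ρ ^ 2) + 12 * ρ ^ 2 * h (ρ ^ 2) * deriv (deriv h) (ρ ^ 2)
      - 8 * ρ ^ 4 * deriv h (ρ ^ 2) * deriv (deriv h) (ρ ^ 2))) :=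
    setIntegral_congr_fun measurableSet_Ioi fun ρ _ => by unfold chanTwo; ring
  rw [hI, hJ]
  push_cast
  ring

/-- `ẽ₄(r²) = eulerPressure (aFour H) 4 r` (`r > 0`). -/
theorem eulerCoeff_four_eq (hh : ContDiff ℝ ∞ h) (hH : ∀ r, 0 ≤ r → H r = h (r ^ 2))
    (hC : ∀ r, 1 ≤ r → r ^ 5 * |H r| ≤ C ∧ r ^ 6 * |deriv H r| ≤ C ∧ r ^ 7 * |deriv (deriv H) r| ≤ C) {r : ℝ} (hr : 0 < r) :
    2 * r ^ 2 * deriv (radCoeff 4 (chanFour h)) (r ^ 2) + 4 * radCoeff 4 (chanFour h) (r ^ 2) = eulerPressure (aFour H) 4 r := by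
  have key := eulerCoeff_radCoeff (contDiff_chanFour hh) 4 (fun σ hσ => abs_chanFour_le hh hH hC hσ) hr
  push_cast at key
  rw [key, eulerPressure, innerMoment_aFour_eq hh hH hr.le, outerMoment_aFour_eq hh hH hr.le]
  have hI : (∫ ρ in (0:ℝ)..r, ρ ^ (2 * 4 + 2) * chanFour h (ρ ^ 2)) = ∫ ρ in (0:ℝ)..r, ρ ^ 10 * (8 * (52 * deriv h (ρ ^ 2) ^ 2
      - 12 * h (ρ ^ 2) * deriv (deriv h) (ρ ^ 2) + 8 * ρ ^ 2 * deriv h (ρ ^ 2) * deriv (deriv h) (ρ ^ 2))) :=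
    intervalIntegral.integral_congr fun ρ _ => by unfold chanFour; ring
  have hJ : (∫ ρ in Ioi r, ρ * chanFour h (ρ ^ 2)) = ∫ ρ in Ioi r, ρ * (8 * (52 * deriv h (ρ ^ 2) ^ 2
      - 12 * h (ρ ^ 2) * deriv (deriv h) (ρ ^ 2) + 8 * ρ ^ 2 * deriv h (ρ ^ 2) * deriv (deriv h) (ρ ^ 2))) :=
    setIntegral_congr_fun measurableSet_Ioi fun ρ _ => by unfold chanFour; ring
  rw [hI, hJ]
  push_cast
  ring

/-! ## The pressure bracket and the bridge by name -/

/-- ★ THE `l = 2` PRESSURE BRACKET: for a quadratic form `Q`, a horn-admissible profile `H`, the smooth divergence-free shell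
`u₀ = sepShell H Q x₀` and the smooth DECAYING solution `p₀` of `Δp₀ = −div((u₀·∇)u₀)`:
`{Y_Q, z·∇p₀(x₀+z)}(r y) = r³ D_Q(y)·(4 e₂(r) − (16/7) r² e₄(r))` for `r > 0`, `|y| = 1`, `e_L = ProfileHorn.eulerPressure (a_L H) L`. -/
theorem pressureBracket_two (hQ : IsQuadForm Q) (hHa : HornAdmissible H) (x₀ : E3)
    (hsm : ContDiff ℝ (⊤ : ℕ∞) (sepShell H Q x₀)) (hdiv : VectorCalculus.IsDivFree (sepShell H Q x₀))
    {p₀ : E3 → ℝ} (hp : ContDiff ℝ (⊤ : ℕ∞) p₀)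
    (hpoi : ∀ x : E3, (Δ p₀) x = -VectorCalculus.divergence (convect (sepShell H Q x₀) (sepShell H Q x₀)) x)
    (hdec : Tendsto p₀ (cocompact E3) (𝓝 0)) {r : ℝ} (hr : 0 < r) {y : E3} (hy : ‖y‖ = 1) :
    pbr (quadY Q) (fun z : E3 => inner ℝ z (gradient p₀ (x₀ + z))) (r • y) =
      r ^ 3 * discrCubic Q y * (4 * eulerPressure (aTwo H) 2 r - 16 / 7 * r ^ 2 * eulerPressure (aFour H) 4 r) := by
  obtain ⟨⟨h, hh, hH⟩, ⟨C, hC⟩⟩ := hHa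
  have hp0 := slicePressure_eq_shellPressure hQ hh hH hC x₀ hsm hdiv hp hpoi hdec
  have hgrad : (fun z : E3 => inner ℝ z (gradient p₀ (x₀ + z))) = fun z => inner ℝ z (gradient (shellPressure Q h) z) := by
    funext z
    rw [hp0, gradient_comp_sub_const (shellPressure Q h) x₀ (x₀ + z), add_sub_cancel_left]
  have hn : ‖r • y‖ ^ 2 = r ^ 2 := by rw [norm_smul, Real.norm_eq_abs, abs_of_pos hr, hy, mul_one]
  rw [hgrad, pbr_quadY_inner_gradient_shellPressure hQ hh hH hC, discrCubic_smul, hn,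
    eulerCoeff_two_eq hh hH hC hr, eulerCoeff_four_eq hh hH hC hr]

/-- ★★ THE HORN SLICE IDENTITY at `l = 2` (`ThreadingJets.HornSliceIdentityTwo`, p704398): the formal second threading jet of the separable
`l = 2` shell with its decaying slice pressure is `K(r)·r³·D_Q(y)·W̃[H](r)` on the sphere of radius `r` about `x₀`. -/
theorem hornSliceIdentityTwo_holds : HornSliceIdentityTwo := by
  intro Q H x₀ p₀ hQ hH hsm hdiv hp hpoi hdec r hr y hy
  rw [fluxJetTwo_sepShell_eq hQ hH x₀ hsm hdiv hp (r • y), pressureBracket_two hQ hH x₀ hsm hdiv hp hpoi hdec hr hy, discrCubic_smul,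
    norm_smul, Real.norm_eq_abs, abs_of_pos hr, hy, mul_one, hornBracket]
  ring

/-- ★★ BRIDGE PH «PROFILE-HORN IDENTITY» BY NAME (`ProfileHorn.HornIdentityTwo`, p689891): for the classical solution on `[t₀,T)` with decaying
pressure issuing from a separable `l = 2` shell, the one-sided second threading jet at `x₀ + r y` is `K(r)·r³·D_Q(y)·W̃[H](r)`.  (M-part = g8's jet
dictionary `ThreadingJets.hornIdentityTwo_of_slice`; L-part = this file.) -/
theorem hornIdentityTwo_holds : ProfileHorn.HornIdentityTwo :=
  ThreadingJets.hornIdentityTwo_of_slice hornSliceIdentityTwo_holds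

/-- ★★ THE `l = 2` SLICE RUNG BY NAME (`ProfileHorn.SeparableShellOrderTwoRigidity`, p689891), UNCONDITIONALLY, FOR EVERY HORN-ADMISSIBLE PROFILE
(plateau profiles included — the plateau work is g7's THEOREM PHR, p692614): a separable `l = 2` shell that is the left-end slice of a classical
solution on `[t₀,T)` with decaying pressure and whose threading flux has vanishing one-sided first and second jets at `t₀` is an axisymmetric slice. -/
theorem separableShellOrderTwoRigidity_holds : ProfileHorn.SeparableShellOrderTwoRigidity :=
  ThreadingJets.separableShellOrderTwoRigidity_of_hornSlice hornSliceIdentityTwo_holds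

end Summit.NavierStokesRegularity.NavierStokesRegularity.Theorems.UnthreadedRigidity.HornPressure

end
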